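import Summits.MatrixMultiplication.MatrixMultiplication.Theorems.AbelianSTPPCensusShapeCertVQDefsS
import Summits.MatrixMultiplication.MatrixMultiplication.Theorems.AbelianSTPPCensusE3KShape

/-!
# Abelian STPP census — the vQK certificate checker `ShapeCertVQ.checkQK` (vQK := vP ∧ E3⁺ ∧ E3K): definitions

Cell mm-stpp, rung F-M1; successor kernel item «vQK T_E ladder beyond 471» (SUCCESSOR-BRIEF RIDER 20 (BB)) in support of the closed
crux item stmt-MatrixMultiplication-19191; seat mm-stpp-vp-p2 (gen 3).

`checkQK M` is vp-p2 g2's vQ certificate search `ShapeCertVQ.checkQS M` (`…ShapeCertVQDefsS`: eng-2's shape records and hereditary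
vM test, theory g6's U11-G node kill and Grynkiewicz continuation bound, g1's E3⁺ node kill, the budgets `qE` / `qS`, the blocked
candidate walk with a level cap) with ONE addition, for the orders `M ≥ 472` where vQ := vP ∧ E3⁺ is no longer exclusionary
(`AbelianSTPPCensusVP.vqpCensusTE_false_above_472`):
* the **E3K node kill** `killK`: a prefix one of whose members `t` (with `2V_t > M`) violates eng-2 g7's Kneser-sharpened three-room
  energy inequality E3K (`STPPThreeRoomEnergy.false_of_energy3k`, p549076) for one of its three pair classes — on shape data,
  `V_t² < e3kLHS M x y z S_A S_B S_C` (`STPPThreeRoomEnergy.e3kLHS`, `…E3KShape`, p550252) for a letter rotation `(x,y,z)` of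
  `(a_t,b_t,c_t)` with the matching rotation of the off-member packing sums of the PREFIX — is dead together with all its completions
  (the kill is hereditary: `STPPThreeRoomEnergy.e3kLHS_mono`, p551598); it is tested at every node next to the E3⁺ kill (`killEK`).
  The Kneser minima `knLB M n` are evaluated from the list of positive divisors of `M` computed ONCE per evaluation (`divsQ`, `knLBd`,
  `e3kLHSd`; `knLBd (divsQ M) = knLB M` definitionally), which the search carries as the parameter `ds`.
The candidate step, the walks and their segments (`stepS`, `innerS`, `loopS`, `segOutS`, `segInS`, `nodeOutS`, `nodeInS`) and the path
nodes (`pathNodeS`) are g2's, reused verbatim with the continuation `dfsK`; new are the node logic `dfsK` / `nodeDecK`, the checker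
`checkQK`, and the path segments `pathOutK` / `pathInK` with their assembly target `PathOKK`.
Soundness: `…ShapeCertVQK{Semantics,Search,SearchP}`; bridge to `SieveAdmissibleVP ∧ E3pAdm ∧ E3kAdm → ¬ Beats (5/2)`:
`…ShapeCertVQKFinal`; kernel evaluations `…ShapeCertVQEvalK*`.
WHAT THIS IS NOT: no statement about STPP families or `ω` by itself; nothing about orders `> 489`; no new rule (E3K is eng-2's
p549076, its shape form p550252) — one more sound node test inside the same search.
-/

set_option linter.dupNamespace false -- `MatrixMultiplication.MatrixMultiplication` (summit = problem, D-0017)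
set_option autoImplicit false

namespace Summit.MatrixMultiplication.MatrixMultiplication.Theorems.ShapeCertVQ

open ShapeCert ShapeCertVP STPPThreeRoomEnergy

/-! ### The Kneser minima from a precomputed divisor list -/

/-- The positive divisors of `M` in increasing order (the list `knLB M` folds over). -/
def divsQ (M : ℕ) : List ℕ := (List.range (M + 1)).filter (fun d => decide (0 < d ∧ d ∣ M))

/-- `knLB` with the divisor list supplied: `knLBd (divsQ M) n = knLB M n` by `rfl` (`…VQKSemantics.knLBd_divsQ`). -/
def knLBd (ds : List ℕ) (n : ℕ) : ℕ :=
  ds.foldr (fun d acc => min (2 * (d * ((n + d - 1) / d)) - d) acc) (2 * n - 1)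

/-- `e3kLHS` with the divisor list supplied (`e3kLHSd (divsQ M) M = e3kLHS M` by `rfl`). -/
def e3kLHSd (ds : List ℕ) (M x y z SA SB SC : ℕ) : ℕ :=
  e3kL M (x * y * z) (knLBd ds x - 1) (knLBd ds y - 1) (knLBd ds z - 1) (knLBd ds (x * y))
    (M - (x * y * z + SA)) (M - (x * y * z + SB)) (M - (x * y * z + SC))

/-- Kernel-strictness idiom for a list of naturals: evaluate every element and cons cell, then continue with the literal list. -/
def seqL {α : Sort*} : List ℕ → (List ℕ → α) → α
  | [], f => f []
  | x :: xs, f => seqN x fun x => seqL xs fun xs => f (x :: xs)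

/-- `seqL` is evaluation order only. -/
@[simp] theorem seqL_eq {α : Sort*} : ∀ (l : List ℕ) (f : List ℕ → α), seqL l f = f l
  | [], _ => rfl
  | x :: xs, f => by rw [seqL, seqN_eq, seqL_eq xs]

/-! ### The E3K node kill -/

/-- E3K kill of member `t` of a prefix with aggregates `A` at order `M` (divisor list `ds`): `2V_t > M` and `V_t² < e3kLHS` for one of
the three pair classes — letters `(a,b,c)` with off-member sums `(S_A,S_B,S_C) = (Σbc − bc_t, Σca − ca_t, Σab − ab_t)`, and the two
rotations `(b,c,a)` / `(c,a,b)` with the sums rotated alike. -/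
def e3kKillT (ds : List ℕ) (M : ℕ) (A : Agg) (t : Sh) : Bool :=
  seqN (A.sbc - t.bc) fun SA => seqN (A.sca - t.ca) fun SB => seqN (A.sab - t.ab) fun SC => seqN (t.V * t.V) fun V2 =>
    decide (M < 2 * t.V) &&
      (decide (V2 < e3kLHSd ds M t.a t.b t.c SA SB SC) || decide (V2 < e3kLHSd ds M t.b t.c t.a SB SC SA) ||
        decide (V2 < e3kLHSd ds M t.c t.a t.b SC SA SB))

/-- E3K kill of a prefix: some member is killed. -/
def killK (ds : List ℕ) (M : ℕ) (A : Agg) (fam : List Sh) : Bool := fam.any (e3kKillT ds M A)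

/-- The node kill of `checkQK`: the E3⁺ kill of `checkQS` or the E3K kill. -/
def killEK (ds : List ℕ) (M : ℕ) (A : Agg) (fam : List Sh) : Bool := killE M A fam || killK ds M A fam

/-! ### The search (node logic of `dfsS` with `killEK` for `killE`; step and walks are `stepS` / `innerS` / `loopS`) -/

/-- The DFS with fuel: `dfsS` with the node kill `killEK`. -/
def dfsK (M : ℕ) (ds : List ℕ) : ℕ → List Sh → List (List Sh) → Bool
  | 0, _, _ => false
  | n + 1, fam, B =>
    (aggOf M fam).force fun A =>
      if killEK ds M A fam then true
      else if M * D < A.gs then false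
      else if A.dead M then true
      else
        let Bs := budsOf M A fam
        if Bs.tailEmpty then decide (A.gs ≤ M * D)
        else
          let S := gnodeQ (headLevQ fam) Bs
          seqN S.bud fun gB => seqN S.idx fun gi =>
            if S.ok && decide (A.gs * K + gB * (tabGQ (headLevQ fam)).get gi ≤ M * D * K) then true
            else
              seqN (A.ra M) fun ra => seqN (A.rb M) fun rb => seqN (A.rc M) fun rc => seqN (A.vl M) fun vl =>
              seqN (A.gs * K) fun g0 => seqN (qOfS M A fam) fun q => seqN (A.kOf M) fun k =>
              seqN (M * D * K) fun mdk =>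
              seqN (breakLevQ g0 q (selOf k) mdk S.ok gB gi) fun lb1 => seqN (lcapS q vl) fun lc =>
                let cl := fam.isEmpty || decide (g0 + selOf k (tabRQ loLev) * q ≤ mdk) || clAnyQ Bs g0 mdk loLev
                loopS M (dfsK M ds n) fam A ra rb rc vl g0 q (selOf k) mdk lb1 lc cl B

/-- The vQK certificate checker `checkQK` at order `M` (`M ≤ Mtop = 489`): the divisor list of `M` evaluated once, then the search. -/
def checkQK (M : ℕ) : Bool := seqL (divsQ M) fun ds => dfsK M ds (M + 2) [] (candBQ M)

/-! ### Path segments (as `…DefsS`, with the node-level decision `nodeDecK` and the continuation `dfsK`) -/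

/-- The node-level decision of `dfsK` at a prefix: `some b` if the node is decided without walking its candidates (E3⁺/E3K kill,
beating prefix, dead prefix, exhausted or closing Grynkiewicz budget), `none` if the walk is needed. -/
def nodeDecK (M : ℕ) (ds : List ℕ) (fam : List Sh) : Option Bool :=
  (aggOf M fam).force fun A =>
    if killEK ds M A fam then some true
    else if M * D < A.gs then some false
    else if A.dead M then some true
    else
      let Bs := budsOf M A fam
      if Bs.tailEmpty then some (decide (A.gs ≤ M * D))
      else
        let S := gnodeQ (headLevQ fam) Bs
        seqN S.bud fun gB => seqN S.idx fun gi =>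
          if S.ok && decide (A.gs * K + gB * (tabGQ (headLevQ fam)).get gi ≤ M * D * K) then some true
          else none

/-- Outer path segment of `checkQK`: at the node of `path` (depth `d`, continuation `dfsK M ds (M + 1 − d)`), the node-level decision,
else the walk of the pool's blocks `i … i + n − 1` (divisor list evaluated once). -/
def pathOutK (M : ℕ) (path : List (ℕ × ℕ)) (i n : ℕ) : Bool :=
  seqL (divsQ M) fun ds =>
    match nodeDecK M ds (pathNodeS M path).1 with
    | some v => v
    | none => nodeOutS M (dfsK M ds (M + 1 - path.length)) (pathNodeS M path).1 n (((pathNodeS M path).2).drop i)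

/-- Inner path segment of `checkQK`: at the node of `path`, the node-level decision, else the walk of the members `j … j + n − 1` of
block `i` of the pool. -/
def pathInK (M : ℕ) (path : List (ℕ × ℕ)) (i j n : ℕ) : Bool :=
  seqL (divsQ M) fun ds =>
    match nodeDecK M ds (pathNodeS M path).1 with
    | some v => v
    | none =>
      match ((pathNodeS M path).2).drop i with
      | [] => true
      | b :: bs => nodeInS M (dfsK M ds (M + 1 - path.length)) (pathNodeS M path).1 bs n (b.drop j)

/-- What the pieces of a node assemble to: the search `dfsK` accepts the node of `path` (with the fuel of `checkQK`). [bookkeeping] -/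
def PathOKK (M : ℕ) (path : List (ℕ × ℕ)) : Prop :=
  dfsK M (divsQ M) (M + 2 - path.length) (pathNodeS M path).1 (pathNodeS M path).2 = true

end Summit.MatrixMultiplication.MatrixMultiplication.Theorems.ShapeCertVQ
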